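import Mathlib
import Summits.SmoothPoincare4.SmoothPoincare4.Theses.VerlindeRLinks
import Literature.Topology.FourManifolds.LinkingNumberPushOffInstance
import HarnessLib.Audit

/-!
# Line `Sketch` (idea `slide-coinvariants`) for crux `VerlindeRLinks.VrlSlideGap` (stmt-SmoothPoincare4-16178)

Lead prover-line-stmt-SmoothPoincare4-16178-0, 2026-08-17 (cycle 1). This is the lead's OWNED copy of the
ideator's `Sketch.lean` (crux-ideate r1 k1; the evidence store is not mounted in the lead's jail, so the shapes
were re-typed from the card `Ideas/slide-coinvariants.md`, which quotes them).

WHAT IS PROVED HERE (0 `sorry`):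
* `firstLemma_slideInvariance_holds` — Habiro, AGT 6 (2006) Prop. 15: a left integral `χ` on a bialgebra is
  invariant under the slide operator `h = (μ ⊗ 1)(1 ⊗ Δ)` (`pair₂ χ ∘ slideOp = pair₂ χ`). Mathlib `Bialgebra`.
* `receptacle` — the card's `ReceptacleShape` as a THEOREM: if an `M`-valued function `J` of framed links changes
  by an element of `N ≤ M` under every `StrictHandleSlideMove`, its class in `M ⧸ N` is a strict-handle-slide
  invariant (induction on `Relation.EqvGen`).
* `vrlSlideGap_of` — the glue, concluding the crux BY NAME:
  `Functorial M N J → Certificate M N J → Summit.SmoothPoincare4.SmoothPoincare4.Theses.VerlindeRLinks.VrlSlideGap`.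

WHAT IS NOT A STUB (and why nothing is registered): `Functorial M N J` (card K3) and `Certificate M N J` (card K2)
are stated for PARAMETERS `(M, N, J)`. The line names them as `M = H^{⊗n}` for `H = u_q(sl₂)`, `N` = Habiro's
relation module (band-reembedding + slides + doubled braidings), `J` = universal invariant of an opening of the
link — none of which can be written over the tree's GEOMETRIC `FramedLink (Fin n)` until a diagrammatic carrier for
multi-component framed links with realisation, Reidemeister completeness and `IsStrictHandleSlide` ↔ band move
exists (definition-sized; the card's D1). With `(M, N, J)` existentially quantified the two statements conjoin to
the crux itself (census §Engines: "no skeleton may be registered on an unnamed σ"), so no `stub_*` is declared.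

K1 (the line's life test, computed this cycle — `Cruxes/VrlSlideGap/NOTES.md`, evidence K1-LITE-REPORT.md): for
`H = u_q(sl₂)`, `p ∈ {3,5,7}`, the dual of the COARSE receptacle `{F ∈ C*⊗C* : F∘h = F, (F∘P)∘h = F∘P}` is exactly
`span{ε⊗ε, χ⊗χ}` (trivial + Hennings), so the coarse `[J_T]` is a 3-manifold invariant and blind on R-links;
Habiro's zero-linking refinement (Remark 16) is the remaining computation.
-/

set_option linter.dupNamespace false

namespace Summit.SmoothPoincare4.SmoothPoincare4.Cruxes.VrlSlideGap.Sketch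

open scoped Manifold ContDiff
open TensorProduct Literature.Topology.FourManifolds

/-! ## 1. The algebraic first lemma (Habiro Prop. 15) -/


/-- Habiro's slide operator `h = (μ ⊗ 1) ∘ (1 ⊗ Δ) : A ⊗ A → A ⊗ A`, `x ⊗ y ↦ ∑ x y₍₁₎ ⊗ y₍₂₎`
(AGT 6 (2006) §12, the operator `h_H` in the symmetric monoidal category of `R`-modules). -/
noncomputable def slideOp (R A : Type*) [CommRing R] [Ring A] [Bialgebra R A] :
    A ⊗[R] A →ₗ[R] A ⊗[R] A :=
  (LinearMap.rTensor A (LinearMap.mul' R A)) ∘ₗ (TensorProduct.assoc R A A A).symm.toLinearMap ∘ₗ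
    (LinearMap.lTensor A Coalgebra.comul)

/-- The functional `χ ⊗ χ` on `A ⊗ A`, multiplied into `R`: `x ⊗ y ↦ χ x * χ y`. -/
noncomputable def pair₂ (R A : Type*) [CommRing R] [Ring A] [Bialgebra R A] (χ : A →ₗ[R] R) :
    A ⊗[R] A →ₗ[R] R :=
  LinearMap.mul' R R ∘ₗ TensorProduct.map χ χ

/-- **First lemma (slide invariance of a left integral).** If `χ : A →ₗ[R] R` is a left integral on the
bialgebra `A`, i.e. `(1 ⊗ χ) ∘ Δ = η ∘ χ` (stated in `A ⊗[R] R` via `TensorProduct.rid`), then `χ ⊗ χ` is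
invariant under the slide operator: `pair₂ χ ∘ slideOp = pair₂ χ`. Habiro (2006), Prop. 15.
[cite: Habiro2006BottomTangles, Prop. 15] -/
def FirstLemma_slideInvariance (R A : Type*) [CommRing R] [Ring A] [Bialgebra R A] : Prop :=
  ∀ (χ : A →ₗ[R] R),
    (LinearMap.lTensor A χ ∘ₗ Coalgebra.comul =
        (TensorProduct.rid R A).symm.toLinearMap ∘ₗ Algebra.linearMap R A ∘ₗ χ) →
      pair₂ R A χ ∘ₗ slideOp R A = pair₂ R A χ

/-- Pointwise computation of `pair₂ χ ∘ slideOp` on `x ⊗ t` for an arbitrary tensor `t : A ⊗ A`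
(to be applied with `t = Δ y`): it equals `χ (x * ρ((1 ⊗ χ) t))`, where `ρ : A ⊗ R ≃ A` is the
right unitor `TensorProduct.rid`. -/
theorem pair₂_slide_tmul_aux (R A : Type*) [CommRing R] [Ring A] [Bialgebra R A]
    (χ : A →ₗ[R] R) (x : A) (t : A ⊗[R] A) :
    LinearMap.mul' R R (TensorProduct.map χ χ (LinearMap.rTensor A (LinearMap.mul' R A)
      ((TensorProduct.assoc R A A A).symm (x ⊗ₜ[R] t)))) =
      χ (x * TensorProduct.rid R A (LinearMap.lTensor A χ t)) := by
  induction t with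
  | zero => simp only [tmul_zero, map_zero, mul_zero]
  | tmul a b =>
    simp only [TensorProduct.assoc_symm_tmul, LinearMap.rTensor_tmul, LinearMap.mul'_apply,
      TensorProduct.map_tmul, LinearMap.lTensor_tmul, TensorProduct.rid_tmul, mul_smul_comm,
      map_smul, smul_eq_mul, mul_comm]
  | add s t hs ht => simp only [tmul_add, map_add, hs, ht, mul_add]

/-- Proof of the first lemma. [cite: Habiro2006BottomTangles, Prop. 15] -/
theorem firstLemma_slideInvariance_holds (R A : Type*) [CommRing R] [Ring A] [Bialgebra R A] :
    FirstLemma_slideInvariance R A := by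
  intro χ hχ
  refine TensorProduct.ext' fun x y => ?_
  have hy : LinearMap.lTensor A χ (Coalgebra.comul y) = (algebraMap R A (χ y)) ⊗ₜ[R] (1 : R) := by
    have := LinearMap.congr_fun hχ y
    simpa only [LinearMap.comp_apply, LinearEquiv.coe_coe, Algebra.linearMap_apply,
      TensorProduct.rid_symm_apply] using this
  simp only [pair₂, slideOp, LinearMap.comp_apply, LinearMap.lTensor_tmul, LinearEquiv.coe_coe,
    TensorProduct.map_tmul, LinearMap.mul'_apply]
  rw [pair₂_slide_tmul_aux, hy, TensorProduct.rid_tmul, one_smul, ← Algebra.commutes,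
    ← Algebra.smul_def, map_smul, smul_eq_mul, mul_comm]


/-! ## 2. The receptacle over the tree's strict handle-slide calculus -/

section Receptacle

variable {M : Type*} [AddCommGroup M] (N : AddSubgroup M) (J : FramedLinkFin → M)

/-- **Functoriality (card K3, shape).** `J` changes by an element of the relation module `N` under every generating
move of the strict handle-slide calculus (isotopy, renumbering, reversal of a component, strict 2-handle slide).
For the line: `M = H^{⊗n}`, `J` = universal invariant of an opening, `N` = Habiro's relations (AGT 2006 Thm 12.1
without stabilisation) — not definable over the tree's geometric `FramedLink` today. -/
def Functorial : Prop :=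
  ∀ L L' : FramedLinkFin, StrictHandleSlideMove L L' → J L' - J L ∈ N

/-- **The receptacle is an invariant** (the card's `ReceptacleShape`, proved): under `Functorial N J` the class of
`J L` in `M ⧸ N` is constant on strict handle-slide equivalence classes (`Relation.EqvGen` induction). [folklore] -/
theorem receptacle (hJ : Functorial N J) {L L' : FramedLinkFin} (h : IsStrictHandleSlideEquivalent L L') :
    (QuotientAddGroup.mk (J L) : M ⧸ N) = QuotientAddGroup.mk (J L') := by
  induction h with
  | rel x y hxy =>
    rw [QuotientAddGroup.eq]
    have := hJ x y hxy
    rwa [sub_eq_neg_add] at this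
  | refl x => rfl
  | symm x y _ ih => exact ih.symm
  | trans x y z _ _ ih₁ ih₂ => exact ih₁.trans ih₂

/-- **Certificate (card K2, shape).** Some R-link (binders copied from the crux: a framed link `L` with `n`
components whose integral surgery is a closed connected `Y ≅ #ⁿ(S² × S¹)`) whose class in `M ⧸ N` differs from the
class of every `0`-framed unlink. For the line: one value `[J_{T₀}] ≠ [J_{T_U}]` for an opening of `L(3,2;4/5)` or
GST's `L₃` in the receptacle of `u_q(sl₂)`. -/
def Certificate : Prop :=
  ∃ (n : ℕ) (L : FramedLink (Fin n)) (Y : Type) (_ : TopologicalSpace Y) (_ : T2Space Y)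
    (_ : SecondCountableTopology Y) (_ : ChartedSpace (EuclideanSpace ℝ (Fin 3)) Y)
    (_ : IsManifold (𝓡 3) ((⊤ : ℕ∞) : WithTop ℕ∞) Y) (_ : CompactSpace Y) (_ : ConnectedSpace Y),
    IsSphereTwoProdCircleSum n Y ∧ L.IsSurgery (𝓡 3) Y ∧
      ∀ U : FramedLink (Fin n), U.IsZeroFramedUnlink →
        (QuotientAddGroup.mk (J ⟨n, L⟩) : M ⧸ N) ≠ QuotientAddGroup.mk (J ⟨n, U⟩)

/-- **Glue (the card's `certificate_gives_crux_shape`), concluding the crux BY NAME**: functoriality + one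
certificate ⇒ `VrlSlideGap`. Pure logic over the binders; the `Knot.TubularNbhd.SmoothnessFacts` witness is the
proved global instance of `LinkingNumberPushOffInstance`. [folklore] -/
theorem vrlSlideGap_of (hJ : Functorial N J) (hC : Certificate N J) :
    Summit.SmoothPoincare4.SmoothPoincare4.Theses.VerlindeRLinks.VrlSlideGap := by
  obtain ⟨n, L, Y, i₁, i₂, i₃, i₄, i₅, i₆, i₇, hY, hL, hgap⟩ := hC
  exact ⟨inferInstance, n, L, Y, i₁, i₂, i₃, i₄, i₅, i₆, i₇, hY, hL,
    fun U hU hLU ↦ hgap U hU (receptacle N J hJ hLU)⟩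

end Receptacle

end Summit.SmoothPoincare4.SmoothPoincare4.Cruxes.VrlSlideGap.Sketch
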